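import Summits.BirchSwinnertonDyer.BirchSwinnertonDyer.Theses.UniversalToricDescent
import Summits.BirchSwinnertonDyer.BirchSwinnertonDyer.Theorems.UniversalToricDescentToricTransportModThreeStubRatSqueeze
import Summits.BirchSwinnertonDyer.BirchSwinnertonDyer.Theorems.UniversalToricDescentAdditiveSplitIMCInclusionAtThreeStubFrame
import Summits.BirchSwinnertonDyer.BirchSwinnertonDyer.Theorems.UniversalToricDescentThinCombContRigidity
import Literature.NumberTheory.EllipticCurves.ToricTwoVariablePAdicLFunction
import Literature.NumberTheory.GaloisRepresentations.AbsGaloisGroup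
import HarnessLib

/-!
# Line `diagonal_waldspurger` — idea #35 (crux-ideate g27) for `AdditiveSplitIMCInclusionAtThree` (stmt-BirchSwinnertonDyer-20395)

NODE (D-0171 contract): a compiling skeleton whose kernel `AdditiveSplitIMCInclusionAtThree_of` concludes the crux BY NAME
from five stub statements; `sorry` occurs ONLY inside `stub_*`.  This is an IDEA NODE, not the registry of record
(`Lines/nakayama_anchor.lean`); it is NOT to be `skeleton check`ed.

## Thesis of the node (what is new relative to #25 `unramified_coleman_axis`, #33, #34 `hecke_residue_certificate`)

Architecture of record (g18–g26): WALL ⟸ RATWALL (24207) ∧ μ-dominance; μ on the `𝔭`-AXIS: S2 (analytic axis `μ = 0`: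
`3 ∤ L₂(T₁,0)`) ∧ S3 (unramified-Coleman Kolyvagin engine) ∧ S4 (axis → anticyclotomic transfer).  #34 decides S2 by ONE
value of `L₂` of norm `> ‖3‖` on or near the axis and declares the ON-axis ramified values "non-classical".

NEW READING (this node).  `Γ̃^∨ = Γ_cyc^∨ ⊕ Γ_ac^∨` (index `2`, a `3`-adic unit): the ON-AXIS TORSION POINT
`x_m = ζ_{3^m}^2 − 1` (the character `κ(γ_𝔭) = ζ², κ(γ_𝔭′) = 1`) IS the product `(χ_m ∘ N_{K/ℚ}) · φ_m` of the CYCLOTOMIC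
Dirichlet character `χ_m` of order `3^m` (conductor `3^{m+1}`) and the ANTICYCLOTOMIC character `φ_m` of order `3^m` with
`φ_m(γ_𝔭) = ζ`: indeed `(ζ·ζ, ζ·ζ⁻¹) = (ζ², 1)`.  Hence the axis torsion values of the `𝐠`-dominant toric function are values of
the toric function OF THE TWISTED NEWFORM `f_E ⊗ χ_m` at FINITE-ORDER anticyclotomic characters, i.e. (p-adic Waldspurger /
BDP at finite order, by continuity of the CM-sum measure; `f_E` is already `3`-depleted since `9 ∣ N`)
    `L₂(x_m, 0) = c_m · ℒ_{f_E ⊗ χ_m}(φ_m)²`,   `ℒ_{f_E⊗χ_m}(φ_m) = Σ_σ φ_m(σ) · F^♭_{χ_m}(x_𝔞^σ)`,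
`F^♭_χ = θ⁻¹(f_E ⊗ χ) = Σ_{3∤n} χ(n) a_n n⁻¹ qⁿ` the (bounded, weight-0) Coleman primitive, so `ℒ_{f⊗χ_m}(φ_m)` is the
`𝔭`-adic logarithm of the `φ_m`-component of a CM-divisor point on `A_{f_E ⊗ χ_m}` — a DIAGONALLY TWISTED HEEGNER LOGARITHM
(diagonal = same order `3^m` in the cyclotomic twist and in the anticyclotomic character).  With B-g26-2
(`v(L₂(x_m,0)) = λ(Ā)·v(ζ_{3^m} − 1)` once `2·3^{m-1} > λ(Ā)`):
    S2 ⟺ ∃ m, ‖ℒ_{f_E⊗χ_m}(φ_m)‖² > ‖3‖/‖c_m‖   ("some diagonal twisted Heegner logarithm is not half-deep at 𝔭").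
This turns S2 from a statement about non-critical Rankin–Selberg limits (B-g26-4) into a NON-DIVISIBILITY STATEMENT FOR
HEEGNER-TYPE CM SUMS in a diagonal `(χ_m, φ_m)` family — the currency of Cornut–Vatsal / Kriz–Li / p-adic CM
equidistribution (Herrero–Menares–Rivera-Letelier), none of which is in play on this crux.

FIRST-ORDER RIGIDITY (proved algebraic core `firstOrderRigidity` below).  Mod `3 = ε²·unit` (`ε = ζ₃ − 1`) an order-`3`
character is a TANGENT VECTOR: `L₂(χ₃∘N · φ) ≡ L̄₂(φ) + ε·(E L̄₂)(φ)` with `E = (1+T₁)∂₁ + (1+T₂)∂₂` the cyclotomic vector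
field.  The anticyclotomic restriction of `L₂` is a unit times a SQUARE (`ℒ²`, Castella–Hsieh), and so is the restriction to
the `χ₃`-translate (`c₁·ℒ_{f⊗χ₃}²`); comparing `ε`-jets at `T = 0`: if the UNIT DOOR is closed (`3 ∣ L₂(0,0)`, i.e.
`λ(ℒ) ≥ 1`) then BOTH first-order coefficients of `L̄₂` vanish (`ā₁₀ = ā₀₁ = 0`).  Consequence: every certificate at an
order-`3` character (near-axis F-g26-a at conductor `𝔭²`, or the `m = 1` diagonal value) detects NOTHING beyond the unit door;
instruments must start at order `9` (`m = 2`).  [NEGATIVE structural result; sharpens #34.]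

CHEAPEST FALSIFIER with teeth both ways (F-g27-c): the valuation of the twist-comparison constant
`c_m = L₂^{(f)}(χ_m∘N·φ) / L₂^{(f⊗χ_m)}(φ)` in Hida's `𝐠`-dominant interpolation formula (ratio of Petersson norms of
`θ_ψ ⊗ χ_m` and `θ_ψ`, root numbers `W(χ_m)`): `v₃(c_m) ≥ 1` for all `m` would force `3 ∣ L₂(T₁,0)` on EVERY row (S2 false,
the axis programme #25/#33/#34 dead); `v₃(c_m) = 0` validates the reading and the rigidity lemma as stated.

Pieces: S1 K3a toric existence (PRINT-ADJACENT·ATTACKABLE) · S2◇ `DiagonalSquareWitness` (UNDECIDED·INSTRUMENTABLE: one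
diagonal twisted Heegner logarithm per row; engine IDEA-NEEDED: diagonal Cornut–Vatsal) · S3 `UnramifiedColemanBound`
(UNDECIDED, XL, verbatim #33) · S4 `AxisToAnticyclotomic` (UNDECIDED·ATTACKABLE under the LEAD's inputs, verbatim #33) ·
S5 RATWALL by name (WEAKER).  Proved here: `axisMuAnalytic_of_diagonalSquareWitness` (S2◇ ⟹ S2), `firstOrderRigidity`,
`norm_le_one_of_one_add_pow_eq_one`, and the #33 composition (re-proved verbatim, g25/g26).

Sources: BDP2013 Thm 5.13; CastellaHsieh2018 §§3–5; KrizLi2019 (doi:10.1017/fms.2019.9) Thm 1.16/3.9 (mod-`p` congruence of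
Heegner logarithms of congruent forms by direct `p`-adic integration — the zeroth-order case of the `ε`-jet reading);
Cornut2002 (Invent. Math. 148); HerreroMenaresRiveraLetelier2020 (arXiv:2002.03232); Hsieh2014 Thm B; Hida1988AIF;
CastellaWan2023 §2.4; Washington1997 §7.2; KEEPKILL-g26 B-g26-2/B-g26-4.
-/
set_option linter.dupNamespace false
set_option autoImplicit false

noncomputable section

open Literature.NumberTheory.EllipticCurves
open Literature.NumberTheory.GaloisRepresentations
open Summit.BirchSwinnertonDyer.BirchSwinnertonDyer.Theses.UniversalToricDescent
  (RationalSplitIMCInclusionAtThree AdditiveSplitIMCInclusionAtThree)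
open Summit.BirchSwinnertonDyer.BirchSwinnertonDyer.Cruxes.ToricTransportModThree.RatwallThinComb
  (dvd_of_dvd_prime_pow_mul prime_C_three not_C_three_dvd_of_norm_coeff_eq_one)
open Summit.BirchSwinnertonDyer.Rank1Residual.X11b
open IsDedekindDomain NumberField Field

namespace Summit.BirchSwinnertonDyer.BirchSwinnertonDyer.Cruxes.AdditiveSplitIMCInclusionAtThree.DiagonalWaldspurger

/-! ## §0 Objects (VERBATIM from `Lines/unramified_coleman_axis.lean` / `Lines/hecke_residue_certificate.lean`; those
`Lines/` modules are not importable under `lean check`, so their `Prop`s are repeated literally). -/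

/-- The `μ`-prime of `R₀⟦T⟧`: the constant series `3`. -/
abbrev threeC : UnrSeries 3 := PowerSeries.C ((3 : ℕ) : unrIntegers 3)

/-- Restriction of `L₂ ∈ R₀⟦T₂⟧⟦T₁⟧` to the `𝔭`-AXIS `T₂ = 0`. [Washington1997 §7.1] -/
def axisRestrict (L₂ : PowerSeries (UnrSeries 3)) : UnrSeries 3 :=
  PowerSeries.map (PowerSeries.constantCoeff (R := unrIntegers 3)) L₂

/-- The `μ = 0` package in divisibility currency (verbatim #33). [GreenbergVatsal2000 §2; Washington1997 §13.2] -/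
def MuZeroPackage (W : WeierstrassCurve ℚ) (K : Type) [Field K] [NumberField K] (κ' : ZpExtension K 3)
    (𝔮 : HeightOneSpectrum (𝓞 K)) (γ' : absoluteGaloisGroup K) [Fact (κ'.IsTopGenerator γ')] : Prop :=
  Module.IsTorsion (IwasawaAlgebra 3) (AcSelmer.XAc (W.baseChange K) 3 κ' 𝔮 ∅ γ') ∧
    ∃ g' : UnrSeries 3,
      (AcSelmer.XAc.charIdeal (W.baseChange K) 3 κ' 𝔮 ∅ γ').map (PowerSeries.map (Halves.toUnr 3)) =
          Ideal.span {g'} ∧ ¬ threeC ∣ g'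

/-! ## §1 Stub statements S2, S3, S4, S1 as `Prop`s (VERBATIM from #33 / #34) -/

/-- **S2 `AxisMuAnalytic`** (verbatim #33): the `𝔭`-axis is not an exceptional line of `L₂ mod 3`. [Hsieh2014 Thm B; CastellaWan2023 §2.4] -/
def AxisMuAnalytic : Prop :=
    ∀ (W : WeierstrassCurve ℚ) [W.IsElliptic] [W.IsGloballyMinimal] (N : ℕ) [NeZero N] (K : Type) [Field K]
      [NumberField K] (Dt : Literature.NumberTheory.EllipticCurves.ModularForms.ModularParametrizationData W N),
    Summit.BirchSwinnertonDyer.Rank1Residual.Additive.ClassO6 W 3 → W.HasSurjectiveModNGaloisRep 3 →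
    W.analyticRank = 1 → W.conductorNorm ℤ = N → IsImaginaryQuadratic K → SatisfiesHeegnerHypothesis N K →
    ∀ (κ : ZpExtension K 3), κ.IsAnticyclotomic → ∀ (γ : Field.absoluteGaloisGroup K) [Fact (κ.IsTopGenerator γ)]
      (𝔭 : HeightOneSpectrum (𝓞 K)), ((3 : ℕ) : 𝓞 K) ∈ 𝔭.asIdeal →
      𝔭.asIdeal.ramificationIdx (𝓞 ℚ) = 1 → 𝔭.asIdeal.inertiaDeg (𝓞 ℚ) = 1 →
    ∀ (𝔭' : HeightOneSpectrum (𝓞 K)), ((3 : ℕ) : 𝓞 K) ∈ 𝔭'.asIdeal → 𝔭' ≠ 𝔭 →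
    ∀ (ι' : PadicAlgCl 3 ≃+* ℂ), Summit.BirchSwinnertonDyer.BirchSwinnertonDyer.Theorems.SchneiderFree.BranchInducesPrime 3 ι' 𝔭 →
    ∀ (κ₁ κ₂ : ZpExtension K 3) (γ₁ γ₂ : Field.absoluteGaloisGroup K) (k : ℕ)
      [Fact (ZpExtension.IsTopGeneratorPair κ₁ κ₂ γ₁ γ₂)],
    (∀ v : HeightOneSpectrum (𝓞 K), v ≠ 𝔭 → ∀ 𝔓 ∈ v.primesAbove,
        𝔓.inertia (Field.absoluteGaloisGroup K) ≤ κ₁.kerSubgroup) →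
    ZpExtension.pairKer κ₁ κ₂ ≤ κ.kerSubgroup → γ₁ * γ⁻¹ ∈ κ.kerSubgroup → γ₂ * (γ ^ (3 ^ k))⁻¹ ∈ κ.kerSubgroup →
    ∀ (ΩK' : ℂ) (Ωp' : ℂ_[3]) (L₂ : PowerSeries (PowerSeries (unrIntegers 3))), ΩK' ≠ 0 → Ωp' ≠ 0 →
      IsToricTwoVarLFunction ι' 𝔭 𝔭' κ₁ κ₂ γ₁ γ₂ Dt.f ΩK' Ωp' L₂ → L₂ ≠ 0 →
    ¬ threeC ∣ axisRestrict L₂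

/-- **S3 `UnramifiedColemanBound`** — THE ENGINE (verbatim #33; UNDECIDED, XL): analytic-to-algebraic `μ`-transfer on the
`𝔭`-axis by the Λ-adic Beilinson–Flach Kolyvagin system with the unramified integral Coleman coordinate at `𝔭′`.
[KLZ17 Thm 10.2.2; LLZ15 §§5.3, 7.4–7.6; Howard2004 Thm 2.2.10; MazurRubin2004 Thm 5.3.10] -/
def UnramifiedColemanBound : Prop :=
    ∀ (W : WeierstrassCurve ℚ) [W.IsElliptic] [W.IsGloballyMinimal] (N : ℕ) [NeZero N] (K : Type) [Field K]
      [NumberField K] (Dt : Literature.NumberTheory.EllipticCurves.ModularForms.ModularParametrizationData W N),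
    Summit.BirchSwinnertonDyer.Rank1Residual.Additive.ClassO6 W 3 → W.HasSurjectiveModNGaloisRep 3 →
    W.analyticRank = 1 → W.conductorNorm ℤ = N → IsImaginaryQuadratic K → SatisfiesHeegnerHypothesis N K →
    ∀ (κ : ZpExtension K 3), κ.IsAnticyclotomic → ∀ (γ : Field.absoluteGaloisGroup K) [Fact (κ.IsTopGenerator γ)]
      (𝔭 : HeightOneSpectrum (𝓞 K)), ((3 : ℕ) : 𝓞 K) ∈ 𝔭.asIdeal →
      𝔭.asIdeal.ramificationIdx (𝓞 ℚ) = 1 → 𝔭.asIdeal.inertiaDeg (𝓞 ℚ) = 1 →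
    ∀ (𝔭' : HeightOneSpectrum (𝓞 K)), ((3 : ℕ) : 𝓞 K) ∈ 𝔭'.asIdeal → 𝔭' ≠ 𝔭 →
    ∀ (ι' : PadicAlgCl 3 ≃+* ℂ), Summit.BirchSwinnertonDyer.BirchSwinnertonDyer.Theorems.SchneiderFree.BranchInducesPrime 3 ι' 𝔭 →
    ∀ (κ₁ κ₂ : ZpExtension K 3) (γ₁ γ₂ : Field.absoluteGaloisGroup K) (k : ℕ)
      [Fact (ZpExtension.IsTopGeneratorPair κ₁ κ₂ γ₁ γ₂)] [Fact (κ₁.IsTopGenerator γ₁)],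
    (∀ v : HeightOneSpectrum (𝓞 K), v ≠ 𝔭 → ∀ 𝔓 ∈ v.primesAbove,
        𝔓.inertia (Field.absoluteGaloisGroup K) ≤ κ₁.kerSubgroup) →
    ZpExtension.pairKer κ₁ κ₂ ≤ κ.kerSubgroup → γ₁ * γ⁻¹ ∈ κ.kerSubgroup → γ₂ * (γ ^ (3 ^ k))⁻¹ ∈ κ.kerSubgroup →
    ∀ (ΩK' : ℂ) (Ωp' : ℂ_[3]) (L₂ : PowerSeries (PowerSeries (unrIntegers 3))), ΩK' ≠ 0 → Ωp' ≠ 0 →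
      IsToricTwoVarLFunction ι' 𝔭 𝔭' κ₁ κ₂ γ₁ γ₂ Dt.f ΩK' Ωp' L₂ → L₂ ≠ 0 →
    ¬ threeC ∣ axisRestrict L₂ → MuZeroPackage W K κ₁ 𝔭 γ₁

/-- **S4 `AxisToAnticyclotomic`** — TRANSFER (verbatim #33; UNDECIDED · ATTACKABLE under the LEAD's two-variable inputs).
[Greenberg2016 Prop. 4.1.1; Hsieh2014 Thm B; KEEPKILL-g18 R-g18-1] -/
def AxisToAnticyclotomic : Prop :=
    ∀ (W : WeierstrassCurve ℚ) [W.IsElliptic] [W.IsGloballyMinimal] (N : ℕ) [NeZero N] (K : Type) [Field K]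
      [NumberField K] (Dt : Literature.NumberTheory.EllipticCurves.ModularForms.ModularParametrizationData W N),
    Summit.BirchSwinnertonDyer.Rank1Residual.Additive.ClassO6 W 3 → W.HasSurjectiveModNGaloisRep 3 →
    W.analyticRank = 1 → W.conductorNorm ℤ = N → IsImaginaryQuadratic K → SatisfiesHeegnerHypothesis N K →
    ∀ (κ : ZpExtension K 3), κ.IsAnticyclotomic → ∀ (γ : Field.absoluteGaloisGroup K) [Fact (κ.IsTopGenerator γ)]
      (𝔭 : HeightOneSpectrum (𝓞 K)), ((3 : ℕ) : 𝓞 K) ∈ 𝔭.asIdeal →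
      𝔭.asIdeal.ramificationIdx (𝓞 ℚ) = 1 → 𝔭.asIdeal.inertiaDeg (𝓞 ℚ) = 1 →
    ∀ (𝔭' : HeightOneSpectrum (𝓞 K)), ((3 : ℕ) : 𝓞 K) ∈ 𝔭'.asIdeal → 𝔭' ≠ 𝔭 →
    ∀ (ι' : PadicAlgCl 3 ≃+* ℂ), Summit.BirchSwinnertonDyer.BirchSwinnertonDyer.Theorems.SchneiderFree.BranchInducesPrime 3 ι' 𝔭 →
    ∀ (κ₁ κ₂ : ZpExtension K 3) (γ₁ γ₂ : Field.absoluteGaloisGroup K) (k : ℕ)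
      [Fact (ZpExtension.IsTopGeneratorPair κ₁ κ₂ γ₁ γ₂)] [Fact (κ₁.IsTopGenerator γ₁)],
    (∀ v : HeightOneSpectrum (𝓞 K), v ≠ 𝔭 → ∀ 𝔓 ∈ v.primesAbove,
        𝔓.inertia (Field.absoluteGaloisGroup K) ≤ κ₁.kerSubgroup) →
    ZpExtension.pairKer κ₁ κ₂ ≤ κ.kerSubgroup → γ₁ * γ⁻¹ ∈ κ.kerSubgroup → γ₂ * (γ ^ (3 ^ k))⁻¹ ∈ κ.kerSubgroup →
    MuZeroPackage W K κ₁ 𝔭 γ₁ → MuZeroPackage W K κ 𝔭' γ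

/-- **S1** K3a statement as a `Prop` (verbatim `Lines/thin_comb.lean` v8.1 / `Lines/nakayama_anchor.lean`). -/
def ToricExistsStatement : Prop :=
    ∀ (W : WeierstrassCurve ℚ) [W.IsElliptic] [W.IsGloballyMinimal] (N : ℕ) [NeZero N] (K : Type) [Field K]
      [NumberField K] (Dt : Literature.NumberTheory.EllipticCurves.ModularForms.ModularParametrizationData W N),
    Summit.BirchSwinnertonDyer.Rank1Residual.Additive.ClassO6 W 3 → W.HasSurjectiveModNGaloisRep 3 →
    W.analyticRank = 1 → W.conductorNorm ℤ = N → IsImaginaryQuadratic K → SatisfiesHeegnerHypothesis N K →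
    ∀ (κ : ZpExtension K 3), κ.IsAnticyclotomic → ∀ (γ : Field.absoluteGaloisGroup K) [Fact (κ.IsTopGenerator γ)]
      (𝔭 : HeightOneSpectrum (𝓞 K)), ((3 : ℕ) : 𝓞 K) ∈ 𝔭.asIdeal →
      𝔭.asIdeal.ramificationIdx (𝓞 ℚ) = 1 → 𝔭.asIdeal.inertiaDeg (𝓞 ℚ) = 1 →
    ∀ (𝔭' : HeightOneSpectrum (𝓞 K)), ((3 : ℕ) : 𝓞 K) ∈ 𝔭'.asIdeal → 𝔭' ≠ 𝔭 →
    ∀ (ι' : PadicAlgCl 3 ≃+* ℂ), Summit.BirchSwinnertonDyer.BirchSwinnertonDyer.Theorems.SchneiderFree.BranchInducesPrime 3 ι' 𝔭 →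
    ∀ (κ₁ κ₂ : ZpExtension K 3) (γ₁ γ₂ : Field.absoluteGaloisGroup K) (k : ℕ)
      [Fact (ZpExtension.IsTopGeneratorPair κ₁ κ₂ γ₁ γ₂)],
    (∀ v : HeightOneSpectrum (𝓞 K), v ≠ 𝔭 → ∀ 𝔓 ∈ v.primesAbove,
        𝔓.inertia (Field.absoluteGaloisGroup K) ≤ κ₁.kerSubgroup) →
    ZpExtension.pairKer κ₁ κ₂ ≤ κ.kerSubgroup → γ₁ * γ⁻¹ ∈ κ.kerSubgroup → γ₂ * (γ ^ (3 ^ k))⁻¹ ∈ κ.kerSubgroup →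
    ∃ (ΩK' : ℂ) (Ωp' : ℂ_[3]) (L₂ : PowerSeries (PowerSeries (unrIntegers 3))),
      ΩK' ≠ 0 ∧ Ωp' ≠ 0 ∧ IsToricTwoVarLFunction ι' 𝔭 𝔭' κ₁ κ₂ γ₁ γ₂ Dt.f ΩK' Ωp' L₂

/-! ## §2 Proved: one value certifies `μ = 0` (re-proved from #34, g26) and the torsion-point norm bound (new) -/

/-- `3 ∤ e`, `3 ∤ L`, `g ∣ (e·L)^(c+1)` ⟹ `3 ∤ g` (verbatim #33). [Washington1997 §7.1] -/
theorem not_threeC_dvd_of_dvd_pow_mul {g e L : UnrSeries 3} {c : ℕ} (he : ¬ threeC ∣ e) (hL : ¬ threeC ∣ L)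
    (hg : g ∣ (e * L) ^ (c + 1)) : ¬ threeC ∣ g := by
  intro h3
  have hmul : ¬ threeC ∣ e * L := fun h ↦ (prime_C_three.dvd_or_dvd h).elim he hL
  exact hmul (prime_C_three.dvd_of_dvd_pow (dvd_trans h3 hg))

/-- Values of `h ∈ R₀⟦T⟧` on the closed unit disc have norm `≤ 1` (re-proved from #34). [Gouvêa §5.6] -/
theorem norm_hasValueAt_le_one {h : UnrSeries 3} {x v : ℂ_[3]} (hx : ‖x‖ ≤ 1)
    (hv : UnrSeries.HasValueAt h x v) : ‖v‖ ≤ 1 := by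
  rw [← hv.tsum_eq]
  refine IsUltrametricDist.norm_tsum_le_of_forall_le_of_nonneg zero_le_one fun n ↦ ?_
  rw [norm_mul, norm_pow]
  exact mul_le_one₀ (Halves.norm_le_one_of_mem_unrIntegers 3 (PowerSeries.coeff n h).2)
    (pow_nonneg (norm_nonneg _) _) (pow_le_one₀ (norm_nonneg _) hx)

/-- ONE VALUE CERTIFIES `μ = 0` (re-proved from #34): a value of norm `> ‖3‖` at a point of the closed unit disc gives `3 ∤ g`.
[Washington1997 §7.2] -/
theorem not_threeC_dvd_of_hasValueAt {g : UnrSeries 3} {x v : ℂ_[3]} (hx : ‖x‖ ≤ 1)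
    (hv : UnrSeries.HasValueAt g x v) (h3 : ‖(3 : ℂ_[3])‖ < ‖v‖) : ¬ threeC ∣ g := by
  rintro ⟨h, rfl⟩
  have h3ne : (3 : ℂ_[3]) ≠ 0 := three_ne_zero
  have hv' : UnrSeries.HasValueAt h x ((3 : ℂ_[3])⁻¹ * v) := by
    unfold UnrSeries.HasValueAt at hv ⊢
    have key : (fun k : ℕ ↦ ((PowerSeries.coeff k h : unrIntegers 3) : ℂ_[3]) * x ^ k) =
        fun k ↦ (3 : ℂ_[3])⁻¹ * (((PowerSeries.coeff k (threeC * h) : unrIntegers 3) : ℂ_[3]) * x ^ k) := by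
      funext k
      have hc : ((PowerSeries.coeff k (threeC * h) : unrIntegers 3) : ℂ_[3]) =
          3 * ((PowerSeries.coeff k h : unrIntegers 3) : ℂ_[3]) := by
        have h33 : ((3 : unrIntegers 3) : ℂ_[3]) = 3 := by
          rfl
        simp [threeC, PowerSeries.coeff_C_mul, h33]
      rw [hc, ← mul_assoc, ← mul_assoc, inv_mul_cancel₀ h3ne, one_mul]
    rw [key]
    exact hv.mul_left _
  have hle : ‖(3 : ℂ_[3])⁻¹ * v‖ ≤ 1 := norm_hasValueAt_le_one hx hv'
  rw [norm_mul, norm_inv, inv_mul_le_iff₀ (norm_pos_iff.mpr h3ne), mul_one] at hle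
  exact (not_lt.mpr hle) h3

/-- Two-variable ON-AXIS form (re-proved from #34): a value of `L₂` at `(x, 0)`, `‖x‖ ≤ 1`, of norm `> ‖3‖` certifies
`3 ∤ L₂(T₁,0)`. [CastellaWan2023 §2.4; Washington1997 §7.2] -/
theorem not_threeC_dvd_axisRestrict_of_hasValueAt₂ {L₂ : PowerSeries (UnrSeries 3)} {x v : ℂ_[3]} (hx : ‖x‖ ≤ 1)
    (hv : UnrSeries.HasValueAt₂ L₂ x 0 v) (h3 : ‖(3 : ℂ_[3])‖ < ‖v‖) : ¬ threeC ∣ axisRestrict L₂ :=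
  not_threeC_dvd_of_hasValueAt hx ((UnrSeries.hasValueAt₂_zero_right_iff L₂ x v).mp hv) h3

/-- **NEW (g27).** An axis TORSION point `x = ζ − 1`, `(1 + x)^n = 1`, `n ≠ 0`, lies in the closed unit disc: `‖1 + x‖ = 1`
and the ultrametric inequality.  (These are the points `x_m = ζ_{3^m}^2 − 1 = (χ_m∘N·φ_m)(γ_𝔭) − 1` of the diagonal reading.)
[Gouvêa §5; folklore] -/
theorem norm_le_one_of_one_add_pow_eq_one {x : ℂ_[3]} {n : ℕ} (hn : n ≠ 0) (h : (1 + x) ^ n = 1) : ‖x‖ ≤ 1 := by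
  have h1 : ‖1 + x‖ = 1 := by
    have hp : ‖1 + x‖ ^ n = 1 := by rw [← norm_pow, h, norm_one]
    exact (pow_eq_one_iff_of_nonneg (norm_nonneg _) hn).mp hp
  have hx : x = (1 + x) + (-1) := by ring
  calc ‖x‖ = ‖(1 + x) + (-1)‖ := by rw [← hx]
    _ ≤ max ‖1 + x‖ ‖(-1 : ℂ_[3])‖ := IsUltrametricDist.norm_add_le_max _ _
    _ = 1 := by rw [h1, norm_neg, norm_one, max_self]

/-! ## §2◇ NEW (g27): the DIAGONAL SQUARE WITNESS and `S2◇ ⟹ S2` -/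

/-- **S2◇ `DiagonalSquareWitness`** (crux-research ∀∃, M as a statement / XL as a theorem — UNDECIDED · INSTRUMENTABLE;
engine IDEA-NEEDED).  In a `thin_comb` frame, for the branch-`𝔭` toric function `L₂ ≠ 0` there are an axis TORSION point
`x` (`(1+x)^{3^m} = 1`; `m = 0`, `x = 0` is the UNIT DOOR), a UNIT `c` and an `s ∈ ℂ₃` with
`L₂(x, 0) = c · s²` and `‖s‖² > ‖3‖`.  READING (line card §A): `x = x_m = ζ_{3^m}^2 − 1` is the character
`(χ_m ∘ N_{K/ℚ})·φ_m` (cyclotomic order-`3^m` Dirichlet twist × anticyclotomic order-`3^m` character), so by the toric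
interpolation for the TWISTED newform `f_E ⊗ χ_m` continued to finite order (p-adic Waldspurger; `f_E = f_E^♭` as `9 ∣ N`)
`c = c_m` is the twist-comparison constant and `s = ℒ_{f_E⊗χ_m}(φ_m) = Σ_σ φ_m(σ)·θ⁻¹(f_E⊗χ_m)(x_𝔞^σ)`, a diagonally twisted
Heegner LOGARITHM; `‖s‖² > ‖3‖` says it is not half-deep in the formal group at `𝔭`.  By B-g26-2, S2 ⟺ such an `m` exists
(any `m` with `2·3^{m-1} > λ(Ā)` works if S2 holds; none if it fails).  AT THE TYPED LEVEL S2◇ ⟺ S2 (take `c = 1`, `s = √v`;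
converse by Weierstrass preparation + B-g26-2): the type fixes WHERE the witness is read (axis torsion points of the closed disc), the
reading of the line card §A says WHAT it is (`s = c_m^{-1/2}·ℒ_{f_E⊗χ_m}(φ_m)`, a diagonally twisted Heegner logarithm) — exactly as
#34's S2♭ is typed as a value and read on the Hecke side.
Why it might fail: (i) `v₃(c_m) > 0` (Petersson-norm / root-number powers of `3` in Hida's formula for the twisted family) —
then on-axis torsion values are uniformly divisible and S2 itself fails (F-g27-c decides this on paper); (ii) S2 false on some
ClassO6 row (`T₂ ∣ L̄₂`); (iii) the finite-order continuation of the twisted toric interpolation at a prime with `3^{2m+2} ∣`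
level is print-adjacent (BDP13 Thm 5.13 and CastellaHsieh2018 are stated for `p ∤ N`; Kriz2021 treats `p ∣ N` by a different
method), though here it is only the CONTINUITY of the CM-sum measure.  By `firstOrderRigidity`, `m = 1` never certifies beyond
the unit door: the first informative instance is `m = 2` (order `9`, `A_{f_E⊗χ_9}` of dimension `6`, ring class field of
conductor `9`).
[BDP2013 Thm 5.13; CastellaHsieh2018 Thm 5.? (`ℒ²` interpolation) ; KrizLi2019 Thm 3.9; Cornut2002; HMRL2020; Hsieh2014 Thm B;
KEEPKILL-g26 B-g26-2] -/
def DiagonalSquareWitness : Prop :=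
    ∀ (W : WeierstrassCurve ℚ) [W.IsElliptic] [W.IsGloballyMinimal] (N : ℕ) [NeZero N] (K : Type) [Field K]
      [NumberField K] (Dt : Literature.NumberTheory.EllipticCurves.ModularForms.ModularParametrizationData W N),
    Summit.BirchSwinnertonDyer.Rank1Residual.Additive.ClassO6 W 3 → W.HasSurjectiveModNGaloisRep 3 →
    W.analyticRank = 1 → W.conductorNorm ℤ = N → IsImaginaryQuadratic K → SatisfiesHeegnerHypothesis N K →
    ∀ (κ : ZpExtension K 3), κ.IsAnticyclotomic → ∀ (γ : Field.absoluteGaloisGroup K) [Fact (κ.IsTopGenerator γ)]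
      (𝔭 : HeightOneSpectrum (𝓞 K)), ((3 : ℕ) : 𝓞 K) ∈ 𝔭.asIdeal →
      𝔭.asIdeal.ramificationIdx (𝓞 ℚ) = 1 → 𝔭.asIdeal.inertiaDeg (𝓞 ℚ) = 1 →
    ∀ (𝔭' : HeightOneSpectrum (𝓞 K)), ((3 : ℕ) : 𝓞 K) ∈ 𝔭'.asIdeal → 𝔭' ≠ 𝔭 →
    ∀ (ι' : PadicAlgCl 3 ≃+* ℂ), Summit.BirchSwinnertonDyer.BirchSwinnertonDyer.Theorems.SchneiderFree.BranchInducesPrime 3 ι' 𝔭 →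
    ∀ (κ₁ κ₂ : ZpExtension K 3) (γ₁ γ₂ : Field.absoluteGaloisGroup K) (k : ℕ)
      [Fact (ZpExtension.IsTopGeneratorPair κ₁ κ₂ γ₁ γ₂)],
    (∀ v : HeightOneSpectrum (𝓞 K), v ≠ 𝔭 → ∀ 𝔓 ∈ v.primesAbove,
        𝔓.inertia (Field.absoluteGaloisGroup K) ≤ κ₁.kerSubgroup) →
    ZpExtension.pairKer κ₁ κ₂ ≤ κ.kerSubgroup → γ₁ * γ⁻¹ ∈ κ.kerSubgroup → γ₂ * (γ ^ (3 ^ k))⁻¹ ∈ κ.kerSubgroup →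
    ∀ (ΩK' : ℂ) (Ωp' : ℂ_[3]) (L₂ : PowerSeries (PowerSeries (unrIntegers 3))), ΩK' ≠ 0 → Ωp' ≠ 0 →
      IsToricTwoVarLFunction ι' 𝔭 𝔭' κ₁ κ₂ γ₁ γ₂ Dt.f ΩK' Ωp' L₂ → L₂ ≠ 0 →
    ∃ (m : ℕ) (x c s : ℂ_[3]), (1 + x) ^ (3 ^ m) = 1 ∧ ‖c‖ = 1 ∧
      UnrSeries.HasValueAt₂ L₂ x 0 (c * s ^ 2) ∧ ‖(3 : ℂ_[3])‖ < ‖s‖ ^ 2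

/-- **S2◇ ⟹ S2** (proved): a diagonal square witness `L₂(x_m, 0) = c·s²`, `‖c‖ = 1`, `‖s‖² > ‖3‖` is an on-axis value of
norm `> ‖3‖` at a point of the closed unit disc. -/
theorem axisMuAnalytic_of_diagonalSquareWitness : DiagonalSquareWitness → AxisMuAnalytic := by
  intro hS W _ _ N _ K _ _ Dt hO6 hsurj hrk hN hK hH κ hκ γ _ 𝔭 h3 hram hdeg 𝔭' h3' hne ι' hι κ₁ κ₂ γ₁ γ₂ k _
    hur₁ hker hγ₁ hγ₂ ΩK' Ωp' L₂ hΩK' hΩp' hL₂ hL0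
  obtain ⟨m, x, c, s, hx, hc, hv, hlt⟩ := hS W N K Dt hO6 hsurj hrk hN hK hH κ hκ γ 𝔭 h3 hram hdeg 𝔭' h3' hne ι' hι
    κ₁ κ₂ γ₁ γ₂ k hur₁ hker hγ₁ hγ₂ ΩK' Ωp' L₂ hΩK' hΩp' hL₂ hL0
  have hxle : ‖x‖ ≤ 1 := norm_le_one_of_one_add_pow_eq_one (pow_ne_zero m three_ne_zero) hx
  have hnorm : ‖(3 : ℂ_[3])‖ < ‖c * s ^ 2‖ := by
    rw [norm_mul, norm_pow, hc, one_mul]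
    exact hlt
  exact not_threeC_dvd_axisRestrict_of_hasValueAt₂ hxle hv hnorm

/-! ## §2♯ NEW (g27): FIRST-ORDER RIGIDITY at the trivial character (proved algebraic core)

Over the residue field `k = 𝔽̄₃` (char `≠ 2`) write the `1`-jet of `L̄₂` at `𝟙` as `a₀₀ + a₁₀T₁ + a₀₁T₂`.  The anticyclotomic
restriction `T₂ = (1+T₁)⁻¹ − 1 = −T₁ + …` is `c₀·ℓ²` (unit × square, `ℓ = ℓ₀ + ℓ₁T + …`): comparing jets,
`a₀₀ = c₀ℓ₀²`, `a₁₀ − a₀₁ = 2c₀ℓ₀ℓ₁`.  The `χ₃`-TRANSLATE is again unit × square with the same residual square root `ℓ₀`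
(Kriz–Li-type congruence), and its `ε`-jet at `T = 0` is the cyclotomic derivative `(E L̄₂)(0) = a₁₀ + a₀₁ = ℓ₀·n`.  If the unit
door is closed (`a₀₀ = 0`) then `ℓ₀ = 0` and both linear coefficients vanish.  -/

/-- **FIRST-ORDER RIGIDITY (algebraic core).**  In a field with `2 ≠ 0`: `a₀₀ = c₀ℓ₀²`, `c₀ ≠ 0`, `a₁₀ − a₀₁ = 2c₀ℓ₀ℓ₁`,
`a₁₀ + a₀₁ = ℓ₀·n` and `a₀₀ = 0` force `a₁₀ = a₀₁ = 0`.  Consequence (line card §B): no certificate at an ORDER-`3`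
character (conductor `𝔭²` near-axis values, the `m = 1` diagonal value) detects anything beyond the unit door.
[KrizLi2019 Thm 3.9 (zeroth order); this node (first order)] -/
theorem firstOrderRigidity {k : Type*} [Field k] (h2 : (2 : k) ≠ 0) {a₀₀ a₁₀ a₀₁ c₀ ℓ₀ ℓ₁ n : k} (hc : c₀ ≠ 0)
    (hsq₀ : a₀₀ = c₀ * ℓ₀ ^ 2) (hsq₁ : a₁₀ - a₀₁ = 2 * c₀ * ℓ₀ * ℓ₁) (htw : a₁₀ + a₀₁ = ℓ₀ * n)
    (hdoor : a₀₀ = 0) : a₁₀ = 0 ∧ a₀₁ = 0 := by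
  have hℓ : ℓ₀ = 0 := by
    have h0 : c₀ * ℓ₀ ^ 2 = 0 := hsq₀.symm.trans hdoor
    exact pow_eq_zero_iff (two_ne_zero) |>.mp ((mul_eq_zero.mp h0).resolve_left hc)
  subst hℓ
  have hd : a₁₀ - a₀₁ = 0 := by rw [hsq₁]; ring
  have hs : a₁₀ + a₀₁ = 0 := by rw [htw]; ring
  have h2a : (2 : k) * a₁₀ = 0 := by linear_combination hd + hs
  have ha : a₁₀ = 0 := (mul_eq_zero.mp h2a).resolve_left h2
  refine ⟨ha, ?_⟩
  rw [ha, zero_add] at hs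
  exact hs

/-- The DIAGONAL DECOMPOSITION behind the reading, as group theory: in a commutative group, the "axis" element `(ζ², 1)` is
the product of the "cyclotomic" `(ζ, ζ)` and the "anticyclotomic" `(ζ, ζ⁻¹)`. [folklore] -/
theorem axis_eq_cyc_mul_ac {G : Type*} [CommGroup G] (ζ : G) :
    ((ζ * ζ, (1 : G)) : G × G) = (ζ, ζ) * (ζ, ζ⁻¹) := by
  ext <;> simp

/-! ## §3 Registered stubs (the `sorry`s of this node) -/

/-- **S1 = K3a `stub_toricExists`** — VERBATIM from `Lines/thin_comb.lean` v8.1 (PRINT-ADJACENT · ATTACKABLE).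
[cite: CastellaWan2023 §2.4 Thm 2.11 (arXiv:1607.02019)] [cite: Hida1988AIF §5 Thm 5.1b] -/
theorem stub_toricExists : ToricExistsStatement := by
  sorry

/-- **S2◇** registered stub (UNDECIDED · INSTRUMENTABLE; engine IDEA-NEEDED), see `DiagonalSquareWitness`.
[BDP2013 Thm 5.13; KrizLi2019 Thm 3.9; Cornut2002; HMRL2020] -/
theorem stub_diagonalSquareWitness : DiagonalSquareWitness := by
  sorry

/-- **S3** registered stub — ENGINE (UNDECIDED, XL), see `UnramifiedColemanBound`. [KLZ17; LLZ15; Howard2004; MazurRubin2004] -/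
theorem stub_unramifiedColemanBound : UnramifiedColemanBound := by
  sorry

/-- **S4** registered stub — TRANSFER (UNDECIDED · ATTACKABLE), see `AxisToAnticyclotomic`. [Greenberg2016 Prop. 4.1.1] -/
theorem stub_axisToAnticyclotomic : AxisToAnticyclotomic := by
  sorry

/-- **S5 `stub_ratwall`** — the route item `RationalSplitIMCInclusionAtThree` (stmt-BirchSwinnertonDyer-24207, LEAD) BY NAME
(WEAKER than the crux: tree theorem `rationalSplitIMCInclusionAtThree_of_wall`). -/
theorem stub_ratwall : RationalSplitIMCInclusionAtThree := by
  sorry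

/-! ## §4 Compositions (kernel-checked; no `sorry` below this line) -/

/-- The #33 composition (re-proved verbatim from g25/g26): S1 · S2 · S3 · S4 · S5 ⟹ the crux BY NAME. -/
theorem AdditiveSplitIMCInclusionAtThree_of_axisMu :
    ToricExistsStatement → AxisMuAnalytic → UnramifiedColemanBound → AxisToAnticyclotomic →
      RationalSplitIMCInclusionAtThree →
      Summit.BirchSwinnertonDyer.BirchSwinnertonDyer.Theses.UniversalToricDescent.AdditiveSplitIMCInclusionAtThree := by
  intro h₁ h₂ h₃ h₄ hR W _ _ N _ K _ _ Dt hO6 hsurj hrk hN hK hH κ hκ γ hγ 𝔭 h3 hram hdeg 𝔭' h3' hne ι' hι ΩK Ωp L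
    hΩK hΩp hL
  -- S5: the rational wall
  obtain ⟨k₀, hk⟩ := hR W N K Dt hO6 hsurj hrk hN hK hH κ hκ γ 𝔭 h3 hram hdeg 𝔭' h3' hne ι' hι ΩK Ωp L hΩK hΩp hL
  -- the frame (landed) and S1 = K3a
  obtain ⟨κ₁, κ₂, γ₁, γ₂, k, hpair, hur₁, hker, hγ₁, hγ₂⟩ :=
    Summit.BirchSwinnertonDyer.BirchSwinnertonDyer.Theorems.UniversalToricDescentThinCombLine.stub_frame K hK κ hκ γ
      hγ.out 𝔭 h3 𝔭' h3' hne
  haveI : Fact (ZpExtension.IsTopGeneratorPair κ₁ κ₂ γ₁ γ₂) := ⟨hpair⟩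
  haveI : Fact (κ₁.IsTopGenerator γ₁) := ⟨hpair.left⟩
  obtain ⟨ΩK', Ωp', L₂, hΩK', hΩp', hL₂⟩ :=
    h₁ W N K Dt hO6 hsurj hrk hN hK hH κ hκ γ 𝔭 h3 hram hdeg 𝔭' h3' hne ι' hι κ₁ κ₂ γ₁ γ₂ k hur₁ hker hγ₁ hγ₂
  -- cross-period rigidity (landed): `L = 0` or `(spec L₂) = (L)`
  rcases Summit.BirchSwinnertonDyer.BirchSwinnertonDyer.Theorems.UniversalToricDescentThinComb.ContRigidity.eq_zero_or_span_spec_eq_of_toric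
      K N Dt.f hK κ hκ γ hγ.out 𝔭 h3 𝔭' h3' hne ι' κ₁ κ₂ γ₁ γ₂ k hpair hγ₁ hγ₂ hΩK hΩp hL hΩK' hΩp' hL₂ with h0 | hspan
  · rw [h0, Ideal.span_singleton_eq_bot.mpr rfl]
    exact bot_le
  by_cases hL0 : L₂ = 0
  · rw [← hspan, hL0, map_zero, Ideal.span_singleton_eq_bot.mpr rfl]
    exact bot_le
  -- S2: the axis is not an exceptional line of `L₂ mod 3`
  have hS2 : ¬ threeC ∣ axisRestrict L₂ :=
    h₂ W N K Dt hO6 hsurj hrk hN hK hH κ hκ γ 𝔭 h3 hram hdeg 𝔭' h3' hne ι' hι κ₁ κ₂ γ₁ γ₂ k hur₁ hker hγ₁ hγ₂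
      ΩK' Ωp' L₂ hΩK' hΩp' hL₂ hL0
  -- S3: the unramified-Coleman Kolyvagin engine transfers analytic `μ = 0` to the axis `μ = 0` package
  have haxis : MuZeroPackage W K κ₁ 𝔭 γ₁ :=
    h₃ W N K Dt hO6 hsurj hrk hN hK hH κ hκ γ 𝔭 h3 hram hdeg 𝔭' h3' hne ι' hι κ₁ κ₂ γ₁ γ₂ k hur₁ hker hγ₁ hγ₂
      ΩK' Ωp' L₂ hΩK' hΩp' hL₂ hL0 hS2
  -- S4: transfer to the anticyclotomic line
  obtain ⟨-, g, hg, hndvd⟩ :=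
    h₄ W N K Dt hO6 hsurj hrk hN hK hH κ hκ γ 𝔭 h3 hram hdeg 𝔭' h3' hne ι' hι κ₁ κ₂ γ₁ γ₂ k hur₁ hker hγ₁ hγ₂ haxis
  -- landed `3`-saturation
  rw [hg] at hk ⊢
  have hdvd : g ∣ ((3 : ℕ) : UnrSeries 3) ^ k₀ * L := Ideal.mem_span_singleton.mp hk
  rw [← map_natCast (PowerSeries.C (R := unrIntegers 3))] at hdvd
  exact Ideal.span_singleton_le_span_singleton.mpr (dvd_of_dvd_prime_pow_mul prime_C_three hndvd k₀ hdvd)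

/-- **TOP COMPOSITION (g27) — concludes the crux `AdditiveSplitIMCInclusionAtThree` BY NAME** from
S1 (toric existence) · S2◇ (a DIAGONAL SQUARE WITNESS: one on-axis torsion value `c·s²`, `c` a unit, `‖s‖² > ‖3‖` — a diagonally
twisted Heegner logarithm that is not half-deep) · S3 (unramified-Coleman engine) · S4 (axis → anticyclotomic transfer) · S5 (RATWALL),
through the proved `S2◇ ⟹ S2` and the #33 composition. -/
theorem AdditiveSplitIMCInclusionAtThree_of :
    ToricExistsStatement → DiagonalSquareWitness → UnramifiedColemanBound → AxisToAnticyclotomic →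
      RationalSplitIMCInclusionAtThree →
      Summit.BirchSwinnertonDyer.BirchSwinnertonDyer.Theses.UniversalToricDescent.AdditiveSplitIMCInclusionAtThree :=
  fun h₁ h₂ h₃ h₄ hR ↦ AdditiveSplitIMCInclusionAtThree_of_axisMu h₁ (axisMuAnalytic_of_diagonalSquareWitness h₂) h₃ h₄ hR

/-- The crux from the five stubs of this node (sanity instance; depends on the five `sorry`s). -/
theorem AdditiveSplitIMCInclusionAtThree_of_stubs :
    Summit.BirchSwinnertonDyer.BirchSwinnertonDyer.Theses.UniversalToricDescent.AdditiveSplitIMCInclusionAtThree :=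
  AdditiveSplitIMCInclusionAtThree_of stub_toricExists stub_diagonalSquareWitness stub_unramifiedColemanBound
    stub_axisToAnticyclotomic stub_ratwall

end Summit.BirchSwinnertonDyer.BirchSwinnertonDyer.Cruxes.AdditiveSplitIMCInclusionAtThree.DiagonalWaldspurger

end
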